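import Summits.HodgeConjecture.HodgeConjecture.Cruxes.BlochSeedDiscOne.KunnethNoInterference
import Summits.HodgeConjecture.HodgeConjecture.Cruxes.BlochSeedDiscOne.SeedCheckerSplitBlockCFree

/-!
# `KunnethNoInterference` in v42.1's `DatumLaw` shape (hsemireg-semihom-1 g67, adapter to c5c8-1 g54's `SeedCheckerSplitBlockCFree`)

line stmt-HodgeConjecture-18881 Cruxes/BlochSeedDiscOne/Lines/birth.lean 814a6a70c14e831a stub_rung_pad4_seedAt — stub UNTOUCHED, never restated.
c5c8-1 g54 RESULT (bus l.13507): «law decls `StaticAlongTW`, `KunnethNoInterference` are consumed as `SplitBlock.DatumLaw` PARAMETERS — please state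
them as `Prop`s over `SplitBlock.SplitBlockDatum₀ E₀ ψ₀ (C-free) importing v42.1».  THIS ADAPTER does exactly that for `KunnethNoInterference`
(file of record `KunnethNoInterference.lean` 47e2ff3c1f7b1e52, which stays v41-only and built): `kniLaw : DatumLaw := fun _ _ δ₀ =>
KunnethNoInterference δ₀.Dsh.shadow δ₀.S.X₃`, the two floor laws of LEMMA Δ and the geometric row in the same shape, `lawAnd`, and the kernel
one-liners giving row 8 of `ShadowRows₀ … σ π` on a C-free datum: (8σ) `budgetClause_sigmaH_of_kniLaw`, (8♮⁺) `budgetClause_phiAllPlus_of_floorLaw`,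
(8♮) `budgetClause_phiAll_of_floorLaw`, the separated discharge `kniLaw_of_phiSepPlusFloorLaw_of_sep`, and the decoration-free exclusion of
B136-shadowed data `not_extBudgetLaw_of_shadow_B136`.  0 `sorry`; no `axiom` ∕ `instance` ∕ `notation`.  A typed law is a HYPOTHESIS; `extBudgetLaw`
is a stub TARGET (pen THEOREM A′ ∕ C), never a law to assume.  NOTHING here is proved toward HC ∕ HC_CM ∕ HC_AV ∕ №4 ∕ 26512 ∕ 18881 ∕ 30548 ∕ H2;
letters ≠ sheaves ≠ SEED; typed ≠ proved.
-/

open CategoryTheory AlgebraicGeometry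
open Literature.AlgebraicGeometry Literature.AlgebraicGeometry.Motives Literature.AlgebraicGeometry.HodgeTheory

namespace Summit.HodgeConjecture.HodgeConjecture.Cruxes.BlochSeedDiscOne.KunnethNoInterference

open Summit.HodgeConjecture.HodgeConjecture.Cruxes.BlochSeedDiscOne.Anchor
open Summit.HodgeConjecture.HodgeConjecture.Cruxes.BlochSeedDiscOne.DepthBoundA4
open Summit.HodgeConjecture.HodgeConjecture.Cruxes.BlochSeedDiscOne.HallB136
open Summit.HodgeConjecture.HodgeConjecture.Cruxes.BlochSeedDiscOne.RuleDPlate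
open Summit.HodgeConjecture.HodgeConjecture.Cruxes.BlochSeedDiscOne.SigmaH
open Summit.HodgeConjecture.HodgeConjecture.Cruxes.BlochSeedDiscOne.RowAlpha3

/-! ## §1 The law in v42.1's `DatumLaw` shape — c5c8-1 g54 RESULT (bus l.13507): «law decls `StaticAlongTW`, `KunnethNoInterference` are consumed
as `SplitBlock.DatumLaw` PARAMETERS — please state them as `Prop`s over `SplitBlock.SplitBlockDatum₀ E₀ ψ₀` (C-free) importing v42.1».

`SplitBlock.DatumLaw := ∀ E₀ ψ₀, SplitBlockDatum₀ E₀ ψ₀ → Prop` (v42.1 §42.5).  On a C-free datum `δ₀` the law reads the pair (shell shadow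
`δ₀.Dsh.shadow`, cokernel sheaf `𝓔 = δ₀.S.X₃`).  Three datum-indexed `Prop`s are offered, of DIFFERENT standing:
* `kniLaw` — THE LAW (a hypothesis; R19.847 (2)): the `Λ`-slot of (8σ) is `Λ := lawAnd StaticAlongTW kniLaw` once `StaticAlongTW` (dual lineage) lands;
* `phiAllPlusFloorLaw` — the decoration-free floor of LEMMA Δ (pen THEOREM-grade, not a hypothesis of the programme; typed as a `DatumLaw` only so that
  (8♮⁺) can be registered in the same F6 shape until the pen half is kernel);
* `extBudgetLaw π` — the GEOMETRIC ROW (pen THEOREM A′ ∕ C: what `δ₀.Passes` + Bloch-semiregularity of the seed give); it is the natural STUB TARGET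
  `∀ δ₀, δ₀.Dsh.Positive → δ₀.Passes → extBudgetLaw 0 E₀ ψ₀ δ₀` of the row-8 conjunct, never a law to assume.
Row 8 of `ShadowRows₀ … σ π` then follows by the kernel one-liners below. -/

section DatumLawShape

open Summit.HodgeConjecture.HodgeConjecture.Cruxes.BlochSeedDiscOne.SeedChecker
open Summit.HodgeConjecture.HodgeConjecture.Cruxes.BlochSeedDiscOne.SeedChecker.SplitBlock

/-- **`KunnethNoInterference` AS A `DatumLaw`** (the `Λ` of (8σ): v42.1 `Rung2b₀Lci (StaticAlongTW ∧ KunnethNoInterference) sigmaH 0` reads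
`Rung2b₀Lci (lawAnd StaticAlongTW kniLaw) sigmaH 0`). -/
def kniLaw (E₀ : AbelianVariety ℂ) (ψ₀ : E₀ ⟶ E₀) (δ : SplitBlockDatum₀ E₀ ψ₀) : Prop :=
  KunnethNoInterference δ.Dsh.shadow δ.S.X₃

/-- the decoration-free floor law of LEMMA Δ as a `DatumLaw` (pen theorem-grade; `KunnethNoInterference.lean` module docstring §B). -/
def phiAllPlusFloorLaw (E₀ : AbelianVariety ℂ) (ψ₀ : E₀ ⟶ E₀) (δ : SplitBlockDatum₀ E₀ ψ₀) : Prop :=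
  PhiAllPlusFloor δ.Dsh.shadow δ.S.X₃

/-- the separated floor law of LEMMA Δ as a `DatumLaw` (pen; separated realisations). -/
def phiSepPlusFloorLaw (E₀ : AbelianVariety ℂ) (ψ₀ : E₀ ⟶ E₀) (δ : SplitBlockDatum₀ E₀ ψ₀) : Prop :=
  PhiSepPlusFloor δ.Dsh.shadow δ.S.X₃

/-- the GEOMETRIC ROW `ext²(𝓔,𝓔) + 28·(r − 4) + π ≤ 3136` as a datum-indexed `Prop` (pen THEOREM A′ ∕ C — a stub TARGET
`∀ δ₀, δ₀.Dsh.Positive → δ₀.Passes → extBudgetLaw 0 E₀ ψ₀ δ₀`, never a law to assume). -/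
def extBudgetLaw (π : ℤ) (E₀ : AbelianVariety ℂ) (ψ₀ : E₀ ⟶ E₀) (δ : SplitBlockDatum₀ E₀ ψ₀) : Prop :=
  ExtBudgetRow π δ.Dsh.shadow δ.S.X₃

/-- conjunction of laws (v42.1 writes `StaticAlongTW ∧ KunnethNoInterference` for the `Λ` of (8σ)). -/
def lawAnd (Λ Λ' : DatumLaw) : DatumLaw := fun E₀ ψ₀ δ => Λ E₀ ψ₀ δ ∧ Λ' E₀ ψ₀ δ

/-- typing certificates: the four are `DatumLaw`s, and the (8σ) ∕ (8♮⁺) instances of v42.1's line #2 rung elaborate with them. -/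
example : DatumLaw := kniLaw
example : DatumLaw := phiAllPlusFloorLaw
example : DatumLaw := phiSepPlusFloorLaw
example (π : ℤ) : DatumLaw := extBudgetLaw π
example (StaticAlongTW : DatumLaw) : Prop := Rung2b₀Lci (lawAnd StaticAlongTW kniLaw) sigmaH 0
example (StaticAlongTW : DatumLaw) : Prop := Rung2b₀Lci (lawAnd StaticAlongTW phiAllPlusFloorLaw) phiAllPlus 0

variable {E₀ : AbelianVariety ℂ} {ψ₀ : E₀ ⟶ E₀}

theorem kniLaw_iff (δ : SplitBlockDatum₀ E₀ ψ₀) : kniLaw E₀ ψ₀ δ ↔ sigmaH δ.Dsh.shadow ≤ (ext2 δ.S.X₃ : ℤ) := Iff.rfl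

theorem extBudgetLaw_iff (π : ℤ) (δ : SplitBlockDatum₀ E₀ ψ₀) :
    extBudgetLaw π E₀ ψ₀ δ ↔ (ext2 δ.S.X₃ : ℤ) + 28 * (δ.Dsh.shadow.rank - 4) + π ≤ 3136 := Iff.rfl

theorem lawAnd_iff {Λ Λ' : DatumLaw} {δ : SplitBlockDatum₀ E₀ ψ₀} : lawAnd Λ Λ' E₀ ψ₀ δ ↔ Λ E₀ ψ₀ δ ∧ Λ' E₀ ψ₀ δ := Iff.rfl

/-- 2b under a conjunction of laws follows from 2b under either conjunct (v42.1 `rung2b₀Under_antitone`). -/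
theorem rung2b₀Under_lawAnd_of_left {Λ Λ' : DatumLaw} {h : ℤ} {Rows : DepthBoundA4.Design → Prop} (h2b : Rung2b₀Under Λ h Rows) :
    Rung2b₀Under (lawAnd Λ Λ') h Rows :=
  rung2b₀Under_antitone (fun _ _ _ hδ => hδ.1) h2b

theorem rung2b₀Under_lawAnd_of_right {Λ Λ' : DatumLaw} {h : ℤ} {Rows : DepthBoundA4.Design → Prop} (h2b : Rung2b₀Under Λ' h Rows) :
    Rung2b₀Under (lawAnd Λ Λ') h Rows :=
  rung2b₀Under_antitone (fun _ _ _ hδ => hδ.2) h2b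

/-- **ROW (8σ) ON A C-FREE DATUM, GIVEN THE LAW**: `kniLaw δ₀ → extBudgetLaw π δ₀ → BudgetClause sigmaH π δ₀.Dsh.shadow`. -/
theorem budgetClause_sigmaH_of_kniLaw (δ : SplitBlockDatum₀ E₀ ψ₀) {π : ℤ} (hk : kniLaw E₀ ψ₀ δ) (h : extBudgetLaw π E₀ ψ₀ δ) :
    BudgetClause sigmaH π δ.Dsh.shadow :=
  budgetClause_sigmaH_of_kni hk h

/-- (8σ) under a conjunction `lawAnd Λ kniLaw` (the shape `StaticAlongTW ∧ KunnethNoInterference`). -/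
theorem budgetClause_sigmaH_of_lawAnd_kniLaw {Λ : DatumLaw} (δ : SplitBlockDatum₀ E₀ ψ₀) {π : ℤ} (hΛ : lawAnd Λ kniLaw E₀ ψ₀ δ)
    (h : extBudgetLaw π E₀ ψ₀ δ) : BudgetClause sigmaH π δ.Dsh.shadow :=
  budgetClause_sigmaH_of_kni hΛ.2 h

/-- **ROW (8♮⁺) ON A C-FREE DATUM, law-free given LEMMA Δ's floor**: `phiAllPlusFloorLaw δ₀ → extBudgetLaw π δ₀ → BudgetClause phiAllPlus π …`. -/
theorem budgetClause_phiAllPlus_of_floorLaw (δ : SplitBlockDatum₀ E₀ ψ₀) {π : ℤ} (hf : phiAllPlusFloorLaw E₀ ψ₀ δ)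
    (h : extBudgetLaw π E₀ ψ₀ δ) : BudgetClause phiAllPlus π δ.Dsh.shadow :=
  budgetClause_phiAllPlus_of_floor hf h

/-- (8♮) in g66's `phiAll` currency wherever `phiAll ≤ phiAllPlus` on the shadow (every design of record: `phiAll = 0`). -/
theorem budgetClause_phiAll_of_floorLaw (δ : SplitBlockDatum₀ E₀ ψ₀) {π : ℤ} (hle : phiAll δ.Dsh.shadow ≤ phiAllPlus δ.Dsh.shadow)
    (hf : phiAllPlusFloorLaw E₀ ψ₀ δ) (h : extBudgetLaw π E₀ ψ₀ δ) : BudgetClause phiAll π δ.Dsh.shadow :=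
  budgetClause_phiAll_of_floor hle hf h

/-- the law DISCHARGED on a datum whose shadow passes the six separated vanishings, given the separated floor (LEMMA NI + LEMMA Δ, separated
realisations): `phiSepPlusFloorLaw δ₀ → SepNoInterferenceRows δ₀.Dsh.shadow → kniLaw δ₀`. -/
theorem kniLaw_of_phiSepPlusFloorLaw_of_sep (δ : SplitBlockDatum₀ E₀ ψ₀) (hf : phiSepPlusFloorLaw E₀ ψ₀ δ)
    (hsep : SepNoInterferenceRows δ.Dsh.shadow) : kniLaw E₀ ψ₀ δ :=
  kni_of_phiSepPlusFloor_of_sep hf hsep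

/-- B136-shadowed data are excluded decoration-free: if `δ₀.Dsh.shadow = B136`, LEMMA Δ's floor refutes the geometric row (`3 920 > 3 136`). -/
theorem not_extBudgetLaw_of_shadow_B136 (δ : SplitBlockDatum₀ E₀ ψ₀) (hB : δ.Dsh.shadow = B136) (hf : phiAllPlusFloorLaw E₀ ψ₀ δ)
    {π : ℤ} (hπ : 0 ≤ π) : ¬ extBudgetLaw π E₀ ψ₀ δ := by
  have hf' : PhiAllPlusFloor δ.Dsh.shadow δ.S.X₃ := hf
  rw [hB] at hf'
  show ¬ ExtBudgetRow π δ.Dsh.shadow δ.S.X₃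
  rw [hB]
  exact not_extBudgetRow_B136 hf' π hπ

end DatumLawShape

end Summit.HodgeConjecture.HodgeConjecture.Cruxes.BlochSeedDiscOne.KunnethNoInterference
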